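import Summits.QuantumFields.YangMills.Theorems.UnitScaleTiltProp7CombTrueStepDefectCell
import HarnessLib

/-!
# Route `UnitScaleTilt`, crux K1 «MinimiserStabilityRegPr» (stmt-QuantumFields-19200), route-R E′ (A′)-on-Σ, P-A2 (β), row «(n3)-comb» `hMcomb` —
# lane (II) file F-6d-1 «CELL MULTIPLICITY OF CORNERED BOXES»: for an `N′s`-periodic `f ≥ 0` on `ℤᵈ`,
# `Σ_{z ∈ [0,N′)ᵈ} Σ_{u ∈ [0,M)ᵈ} f(s•z + u) ≤ ⌈M∕s⌉ᵈ · Σ_{y ∈ [0,N′s)ᵈ} f(y)`, period-cell sums are invariant under EVERY lattice shift, and the top-pair double block counts `L` times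

Cell `ym3-torus` (HUMAN RULING D-0037: YM₃ on the torus is ladder rung R3 — not d = 4, not a mass gap, not Clay), D-0154 (3c) R3 twin-width seat `ym-routeR-w6` (gen 9);
★routeR-w1 g9 PENS ROUND 4 (2026-08-29 08:50:39Z) «F-6d Σ OVER CORNERS + MULTIPLICITIES + TRANSFER KNIT → routeR-w6», bookkeeping steps (1) and (3): «Σ_z of a sum over the boxes
`Q_j(q_j(z)) = q_j(z) + [0,L²+L)ᵈ` ≤ MULTIPLICITY·Σ over the level-j cell, multiplicity ≤ (2L)ᵈ per level (boxes of side ≤ 2L² at spacing `L^{k−j} ≥ L`; count by ✓`sum_cell_tiling`-type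
re-indexing)» and «periodicity of every level-j object … so that cell sums are shift-invariant (✓F-5c `sum_cell_shift`)».  `--supports stmt-QuantumFields-19200 --as helper`; THEOREMS ONLY
(0 `def`, 0 `sorry`); count-neutral.  «(O2) groundwork — route-internal row (n3)-comb, NOT N06, NOT a print row; OPEN».  Nothing of `hMcomb`, `hMcomb₂`, (β), `hPA2`, `hcoS`, E′, EX,
the stub, the crux, d = 4 or the gap is claimed.

THE POINT.  The per-corner row of the (II) design (w3-19200 g13 ✓F-6c-3a `normSq_covGrad_le_of_rows` dressed by ★routeR-w1 ✓F-6c-2b and F-6c-3b) bounds the covariant gradient of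
the coarse gauge function at ONE level-k corner `(z, κ)` by sums over BOXES of the lower levels, all CORNERED at the images `q_j(z) = L^{k−j}•z` of that corner: the cubes
`q_j(z) + [0, L²+L)ᵈ` (F-6c-2b's GRAD∕MASS letters), the blocks `q_i(z) + [0,L)ᵈ` (✓F-6a-2 §3's oscillation), the defect blocks `q_{j+1}(z) + [0,L)ᵈ`, the double block of the
top pair (F-6c-3b), and the same boxes at the neighbour `z + e_κ`.  F-6d sums that row over the level-k period cell `z ∈ [0,N_k)ᵈ`, `κ`.  This file is the COUNTING: with
`N_j = N_k·L^{k−j}` and every level-j object `N_j`-periodic (W1, one period cell on `ℤᵈ` — MASTER §2), (§1) a period-cell sum of a periodic function is invariant under EVERY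
lattice translation (✓F-5c `sum_cell_shift` iterated over `ℤ` and over the directions — so the neighbour's boxes cost exactly what the corner's do), (§2) a box sum only grows with
the box (`f ≥ 0`), (§3) ★ the boxes of side `M` cornered at the dilated cell `s•[0,N′)ᵈ` cover the fine cell `[0,N′s)ᵈ` at most `⌈M∕s⌉ᵈ` times: enlarge the box to side `A·s ≥ M`,
tile it by `Aᵈ` translates of `[0,s)ᵈ` (✓F-5c `sum_cell_tiling` read locally), and each translate family `{s•(z + a) + [0,s)ᵈ}_z` tiles the fine cell exactly (✓`sum_cell_tiling` + §1)
— multiplicity `Aᵈ`, i.e. `(L+1)ᵈ` for the cubes (`M = L²+L`, `s = L^{k−j} ≥ L`), `1` for the blocks below the top, `Lᵈ` for the top defect block; (§4) the top pair's double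
block `Σ_{s ∈ [0,L)ᵈ} Σ_{t<L} f(L•z + s + t•e_κ)` summed over `z` is EXACTLY `L` fine-cell sums (one exact tiling per `t`, shifted back by §1).

WHAT IS PROVED (ns `…Theorems.Prop7CellBoxMultiplicity`; generic `ℤᵈ`, every `d`; sums valued in `ℝ` (§1 in any additive commutative monoid)).
* §1 `sum_cell_shift_zsmul` (`Σ_z g(z + m•e_κ) = Σ_z g(z)`, `m : ℤ`), ★`sum_cell_shift_vec` (`Σ_z g(z + v) = Σ_z g(z)`, any `v : ℤᵈ`), for `N′`-periodic `g` over the cell `[0,N′)ᵈ`.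
* §2 `sum_box_mono` (`[0,M)ᵈ ⊆ [0,M′)ᵈ`, `f ≥ 0`).
* §3 ★★ `sum_cell_sum_box_le` — the title, with a free name `Nj = N′·s` for the fine cell; ★`sum_cell_sum_box_shift_le` — the same for boxes cornered at `s•(z + v)` (the neighbour `v = e_κ`);
  `sum_cell_block_shift_eq` — blocks of side exactly `s` at the shifted corners tile the fine cell EXACTLY (multiplicity 1, equality).
* §4 ★`sum_cell_block_seg_eq` — `Σ_z Σ_{s ∈ [0,L)ᵈ} Σ_{t<L} f(L•z + s + t•e_κ) = L·Σ_{y ∈ [0,N′L)ᵈ} f(y)`.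
HONEST SCOPE.  Finite re-indexing on `ℤᵈ`; no field, no transport, no level recursion, no member; the knit (F-6d-2) applies these to F-6c-3c's letters.  Rung R3, not Clay; YM gap NOT proved.

References: T. Bałaban, CMP **98** (1985) 17–51 [Balaban1985Averaging] ((2) p.17 (blocks `B(y)`), (125)–(126) p.36 (sums over blocks of blocks)); CMP **109** (1987) 249–301 [Balaban1987RG1]
((0.1) p.251 (periodic configurations on the torus as configurations on `ℤᵈ`)); M. Giaquinta, *Multiple integrals in the calculus of variations and nonlinear elliptic systems* (1983)
[Giaquinta1984] (Ch. III §1 p.70, covering multiplicity of dilated cubes).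
-/

set_option autoImplicit false

noncomputable section

open scoped BigOperators

namespace Summit.QuantumFields.YangMills.Theorems.Prop7CellBoxMultiplicity

open Literature.MathematicalPhysics.QuantumFieldTheory.Balaban1983to89
open B7Prop1Explicit (Site e boxVec e_apply sum_zsmul_e)
open Summit.QuantumFields.YangMills.Theorems.Prop7CombTrueStepDefectCell (sum_cell_tiling sum_cell_shift)

variable {d : ℕ}

/-! ## §1 Period-cell sums are invariant under every lattice translation -/

section Shift

variable {M : Type*} [AddCommMonoid M]

/-- **SHIFT BY `m•e_κ`, `m : ℤ`**: for an `N′`-periodic `g`, `Σ_{z ∈ [0,N′)ᵈ} g(z + m•e_κ) = Σ_z g(z)` — ✓F-5c `sum_cell_shift` (the unit shift) iterated up and down the integers.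
[cite: Balaban1987RG1, (0.1) p.251] -/
theorem sum_cell_shift_zsmul (N' : ℕ) [NeZero N'] (g : Site d → M) (hg : ∀ (x : Site d) (κ : Fin d), g (x + (N' : ℤ) • e κ) = g x)
    (κ : Fin d) (m : ℤ) :
    ∑ z : Fin d → Fin N', g (boxVec N' z + m • e κ) = ∑ z : Fin d → Fin N', g (boxVec N' z) := by
  induction m using Int.induction_on with
  | zero => simp
  | succ m ih =>
    -- `g_m := g(· + m•e_κ)` is periodic; one unit shift more
    have hper : ∀ x : Site d, g (x + (N' : ℤ) • e κ + (m : ℤ) • e κ) = g (x + (m : ℤ) • e κ) := fun x => by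
      rw [add_right_comm, hg]
    have h := sum_cell_shift N' (fun x => g (x + (m : ℤ) • e κ)) κ hper
    rw [← ih, ← h]
    refine Finset.sum_congr rfl fun z _ => ?_
    congr 1; rw [add_smul, one_smul, add_assoc, add_comm (e κ)]
  | pred m ih =>
    -- one unit shift applied to `g_{−m−1} := g(· + (−m−1)•e_κ)` gives back level `−m`
    have hper : ∀ x : Site d, g (x + (N' : ℤ) • e κ + (-(m : ℤ) - 1) • e κ) = g (x + (-(m : ℤ) - 1) • e κ) := fun x => by
      rw [add_right_comm, hg]
    have h := sum_cell_shift N' (fun x => g (x + (-(m : ℤ) - 1) • e κ)) κ hper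
    rw [← ih, ← h]
    refine Finset.sum_congr rfl fun z _ => ?_
    have haux : (-(m : ℤ) - 1) • e κ + e κ = (-(m : ℤ)) • e κ := by rw [sub_smul, one_smul, sub_add_cancel]
    congr 1
    rw [add_assoc, ← haux, add_comm (e κ)]

/-- ★ **SHIFT BY ANY LATTICE VECTOR**: for an `N′`-periodic `g` (period `N′` in every direction) and every `v ∈ ℤᵈ`, `Σ_{z ∈ [0,N′)ᵈ} g(z + v) = Σ_z g(z)` — `v = Σ_κ v_κ•e_κ`
(lit `sum_zsmul_e`) and §1 one direction at a time. [cite: Balaban1987RG1, (0.1) p.251] -/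
theorem sum_cell_shift_vec (N' : ℕ) [NeZero N'] (g : Site d → M) (hg : ∀ (x : Site d) (κ : Fin d), g (x + (N' : ℤ) • e κ) = g x)
    (v : Site d) :
    ∑ z : Fin d → Fin N', g (boxVec N' z + v) = ∑ z : Fin d → Fin N', g (boxVec N' z) := by
  classical
  -- induction over the set of directions carrying the shift
  suffices h : ∀ S : Finset (Fin d), ∑ z : Fin d → Fin N', g (boxVec N' z + ∑ κ ∈ S, v κ • e κ) = ∑ z : Fin d → Fin N', g (boxVec N' z) by
    have := h Finset.univ
    rwa [sum_zsmul_e] at this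
  intro S
  induction S using Finset.induction_on with
  | empty => simp
  | insert κ₀ S hκ₀ ih =>
    rw [Finset.sum_insert hκ₀]
    -- shift the periodic function `x ↦ g(x + Σ_{S} …)` by `v κ₀ • e κ₀`
    have hper : ∀ (x : Site d) (κ : Fin d), g (x + (N' : ℤ) • e κ + ∑ κ ∈ S, v κ • e κ) = g (x + ∑ κ ∈ S, v κ • e κ) := fun x κ => by
      rw [add_right_comm, hg]
    have h := sum_cell_shift_zsmul N' (fun x => g (x + ∑ κ ∈ S, v κ • e κ)) hper κ₀ (v κ₀)
    rw [← ih, ← h]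
    refine Finset.sum_congr rfl fun z _ => ?_
    congr 1; abel

end Shift

/-! ## §2 Box sums grow with the box -/

/-- **BOX MONOTONICITY**: for `f ≥ 0` and `M ≤ M′`, `Σ_{u ∈ [0,M)ᵈ} f(q + u) ≤ Σ_{u′ ∈ [0,M′)ᵈ} f(q + u′)` (the index injection `Fin.castLE` coordinatewise; nonnegative terms).
[folklore] [cite: Giaquinta1984, Ch. III §1 p.70] -/
theorem sum_box_mono {M M' : ℕ} (hMM' : M ≤ M') (f : Site d → ℝ) (hf : ∀ y, 0 ≤ f y) (q : Site d) :
    ∑ u : Fin d → Fin M, f (q + boxVec M u) ≤ ∑ u' : Fin d → Fin M', f (q + boxVec M' u') := by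
  classical
  -- the coordinatewise `castLE` injection
  let ι : (Fin d → Fin M) → (Fin d → Fin M') := fun u i => Fin.castLE hMM' (u i)
  have hι : Function.Injective ι := by
    intro u u' h
    funext i
    have := congr_fun h i
    exact Fin.castLE_injective hMM' this
  have hbox : ∀ u, boxVec M' (ι u) = boxVec M u := fun u => by
    funext i; simp [boxVec, ι]
  calc ∑ u : Fin d → Fin M, f (q + boxVec M u)
      = ∑ u : Fin d → Fin M, f (q + boxVec M' (ι u)) := Finset.sum_congr rfl fun u _ => by rw [hbox]
    _ = ∑ u' ∈ Finset.univ.image ι, f (q + boxVec M' u') := by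
        rw [Finset.sum_image fun u _ u' _ h => hι h]
    _ ≤ ∑ u' : Fin d → Fin M', f (q + boxVec M' u') :=
        Finset.sum_le_sum_of_subset_of_nonneg (Finset.subset_univ _) fun u' _ _ => hf _

/-! ## §3 ★★ The multiplicity of cornered boxes over a dilated cell -/

/-- ★★ **CELL MULTIPLICITY OF CORNERED BOXES**: `f ≥ 0` on `ℤᵈ`, `Nj = N′·s`-periodic in every direction (`s ≥ 1`); boxes of side `M ≤ A·s` cornered at the dilated cell points `s•z`,
`z ∈ [0,N′)ᵈ`.  Then `Σ_{z ∈ [0,N′)ᵈ} Σ_{u ∈ [0,M)ᵈ} f(s•z + u) ≤ Aᵈ · Σ_{y ∈ [0,Nj)ᵈ} f(y)` — every fine site is covered at most `Aᵈ = ⌈M∕s⌉ᵈ` times.  (Level-j reading: `s = L^{k−j}`,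
`N′ = N_k`, `Nj = N_j`; cubes `M = L²+L ≤ (L+1)·s` for `j < k`; blocks `M = L ≤ 1·s` for `j < k`; the top defect block `M = L = L·1` at `j+1 = k`.)
[cite: Balaban1985Averaging, (2) p.17, (125)-(126) p.36; Giaquinta1984, Ch. III §1 p.70] -/
theorem sum_cell_sum_box_le (N' s M A : ℕ) [NeZero N'] (hs : 1 ≤ s) (hMA : M ≤ A * s) (Nj : ℕ) (hNj : Nj = N' * s)
    (f : Site d → ℝ) (hf : ∀ y, 0 ≤ f y) (hfp : ∀ (y : Site d) (κ : Fin d), f (y + (Nj : ℤ) • e κ) = f y) :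
    ∑ z : Fin d → Fin N', ∑ u : Fin d → Fin M, f ((s : ℤ) • boxVec N' z + boxVec M u)
      ≤ (A : ℝ) ^ d * ∑ y : Fin d → Fin Nj, f (boxVec Nj y) := by
  classical
  subst hNj
  haveI : NeZero (N' * s) := ⟨Nat.mul_ne_zero (NeZero.ne N') (by omega)⟩
  -- (i) enlarge each box to side `A·s`
  have h1 : ∀ z : Fin d → Fin N', ∑ u : Fin d → Fin M, f ((s : ℤ) • boxVec N' z + boxVec M u)
      ≤ ∑ u' : Fin d → Fin (A * s), f ((s : ℤ) • boxVec N' z + boxVec (A * s) u') := fun z => sum_box_mono hMA f hf _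
  -- (ii) tile the big box by `Aᵈ` blocks of side `s`: `u′ = s•a + b`
  have h2 : ∀ z : Fin d → Fin N', ∑ u' : Fin d → Fin (A * s), f ((s : ℤ) • boxVec N' z + boxVec (A * s) u')
      = ∑ a : Fin d → Fin A, ∑ b : Fin d → Fin s, f ((s : ℤ) • boxVec N' z + ((s : ℤ) • boxVec A a + boxVec s b)) := fun z =>
    sum_cell_tiling A s hs (fun y => f ((s : ℤ) • boxVec N' z + y))
  -- (iii) for each translate `a`, the blocks `s•(z + a) + [0,s)ᵈ` tile the fine cell exactly (tiling + shift by `s•a`)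
  have h3 : ∀ a : Fin d → Fin A, ∑ z : Fin d → Fin N', ∑ b : Fin d → Fin s, f ((s : ℤ) • boxVec N' z + ((s : ℤ) • boxVec A a + boxVec s b))
      = ∑ y : Fin d → Fin (N' * s), f (boxVec (N' * s) y) := by
    intro a
    have ht := sum_cell_tiling N' s hs (fun y => f (y + (s : ℤ) • boxVec A a))
    have hsh := sum_cell_shift_vec (N' * s) (fun y => f y) (fun y κ => hfp y κ) ((s : ℤ) • boxVec A a)
    rw [← hsh, ht]
    refine Finset.sum_congr rfl fun z _ => Finset.sum_congr rfl fun b _ => ?_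
    congr 1; abel
  -- assemble
  calc ∑ z : Fin d → Fin N', ∑ u : Fin d → Fin M, f ((s : ℤ) • boxVec N' z + boxVec M u)
      ≤ ∑ z : Fin d → Fin N', ∑ u' : Fin d → Fin (A * s), f ((s : ℤ) • boxVec N' z + boxVec (A * s) u') := Finset.sum_le_sum fun z _ => h1 z
    _ = ∑ z : Fin d → Fin N', ∑ a : Fin d → Fin A, ∑ b : Fin d → Fin s, f ((s : ℤ) • boxVec N' z + ((s : ℤ) • boxVec A a + boxVec s b)) :=
        Finset.sum_congr rfl fun z _ => h2 z
    _ = ∑ a : Fin d → Fin A, ∑ z : Fin d → Fin N', ∑ b : Fin d → Fin s, f ((s : ℤ) • boxVec N' z + ((s : ℤ) • boxVec A a + boxVec s b)) :=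
        Finset.sum_comm
    _ = ∑ a : Fin d → Fin A, ∑ y : Fin d → Fin (N' * s), f (boxVec (N' * s) y) := Finset.sum_congr rfl fun a _ => h3 a
    _ = (A : ℝ) ^ d * ∑ y : Fin d → Fin (N' * s), f (boxVec (N' * s) y) := by
        rw [Finset.sum_const, Finset.card_univ, Fintype.card_fun, Fintype.card_fin, Fintype.card_fin, nsmul_eq_mul]
        push_cast; ring

/-- ★ **THE SAME AT SHIFTED CORNERS** (the neighbour `z + e_κ` of the per-corner row, or any `v ∈ ℤᵈ`): `Σ_{z ∈ [0,N′)ᵈ} Σ_{u ∈ [0,M)ᵈ} f(s•(z + v) + u) ≤ Aᵈ · Σ_{y ∈ [0,Nj)ᵈ} f(y)` —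
the box sum as a function of the corner is `N′`-periodic, so §1 moves the corners back. [cite: Balaban1985Averaging, (2) p.17, (125)-(126) p.36; Balaban1987RG1, (0.1) p.251] -/
theorem sum_cell_sum_box_shift_le (N' s M A : ℕ) [NeZero N'] (hs : 1 ≤ s) (hMA : M ≤ A * s) (Nj : ℕ) (hNj : Nj = N' * s)
    (f : Site d → ℝ) (hf : ∀ y, 0 ≤ f y) (hfp : ∀ (y : Site d) (κ : Fin d), f (y + (Nj : ℤ) • e κ) = f y) (v : Site d) :
    ∑ z : Fin d → Fin N', ∑ u : Fin d → Fin M, f ((s : ℤ) • (boxVec N' z + v) + boxVec M u)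
      ≤ (A : ℝ) ^ d * ∑ y : Fin d → Fin Nj, f (boxVec Nj y) := by
  -- the box sum as a function of the (undilated) corner is `N′`-periodic
  have hper : ∀ (w : Site d) (κ : Fin d), (∑ u : Fin d → Fin M, f ((s : ℤ) • (w + (N' : ℤ) • e κ) + boxVec M u))
      = ∑ u : Fin d → Fin M, f ((s : ℤ) • w + boxVec M u) := by
    intro w κ
    refine Finset.sum_congr rfl fun u _ => ?_
    have e1 : (s : ℤ) • (w + (N' : ℤ) • e κ) + boxVec M u = ((s : ℤ) • w + boxVec M u) + (Nj : ℤ) • e κ := by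
      rw [hNj, smul_add, smul_smul]; push_cast; rw [mul_comm (s : ℤ)]; abel
    rw [e1, hfp]
  have hsh := sum_cell_shift_vec N' (fun w => ∑ u : Fin d → Fin M, f ((s : ℤ) • w + boxVec M u)) hper v
  rw [hsh]
  exact sum_cell_sum_box_le N' s M A hs hMA Nj hNj f hf hfp

/-- **BLOCKS OF SIDE EXACTLY `s` AT SHIFTED CORNERS TILE THE FINE CELL EXACTLY** (multiplicity one, equality; any additive commutative monoid): for `Nj = N′s`-periodic `f` and any
`v ∈ ℤᵈ`, `Σ_{z ∈ [0,N′)ᵈ} Σ_{b ∈ [0,s)ᵈ} f(s•(z + v) + b) = Σ_{y ∈ [0,Nj)ᵈ} f(y)` (✓`sum_cell_tiling` + §1). The level-i blocks `B^i(q_i(z))` and `B^i(q_i(z + e_κ))`, `i < k`.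
[cite: Balaban1985Averaging, (2) p.17; Balaban1987RG1, (0.1) p.251] -/
theorem sum_cell_block_shift_eq {M : Type*} [AddCommMonoid M] (N' s : ℕ) [NeZero N'] (hs : 1 ≤ s) (Nj : ℕ) (hNj : Nj = N' * s)
    (f : Site d → M) (hfp : ∀ (y : Site d) (κ : Fin d), f (y + (Nj : ℤ) • e κ) = f y) (v : Site d) :
    ∑ z : Fin d → Fin N', ∑ b : Fin d → Fin s, f ((s : ℤ) • (boxVec N' z + v) + boxVec s b)
      = ∑ y : Fin d → Fin Nj, f (boxVec Nj y) := by
  subst hNj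
  haveI : NeZero (N' * s) := ⟨Nat.mul_ne_zero (NeZero.ne N') (by omega)⟩
  have ht := sum_cell_tiling N' s hs (fun y => f (y + (s : ℤ) • v))
  have hsh := sum_cell_shift_vec (N' * s) f hfp ((s : ℤ) • v)
  rw [← hsh, ht]
  refine Finset.sum_congr rfl fun z _ => Finset.sum_congr rfl fun b _ => ?_
  congr 1; rw [smul_add]; abel

/-! ## §4 ★ The top pair's double block counts `L` times -/

/-- ★ **THE DOUBLE BLOCK OF THE TOP PAIR**: for an `N′L`-periodic `f` (any additive commutative monoid) and a direction `κ`,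
`Σ_{z ∈ [0,N′)ᵈ} Σ_{s ∈ [0,L)ᵈ} Σ_{t<L} f(L•z + s + t•e_κ) = L • Σ_{y ∈ [0,N′L)ᵈ} f(y)` — for each `t` the blocks `L•z + t•e_κ + [0,L)ᵈ` tile the fine cell exactly (§3 with `v` replaced by
the fine shift `t•e_κ`, i.e. ✓`sum_cell_tiling` + §1).  This is F-6c-3b's «each κ-bond of the double block is visited ≤ L times», as an identity over the cell.
[cite: Balaban1985Averaging, (2) p.17, (42)-(47) pp.23-25; Balaban1987RG1, (0.1) p.251] -/
theorem sum_cell_block_seg_eq {M : Type*} [AddCommMonoid M] (N' L : ℕ) [NeZero N'] (hL : 1 ≤ L) (Nj : ℕ) (hNj : Nj = N' * L)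
    (f : Site d → M) (hfp : ∀ (y : Site d) (κ : Fin d), f (y + (Nj : ℤ) • e κ) = f y) (κ : Fin d) :
    ∑ z : Fin d → Fin N', ∑ s : Fin d → Fin L, ∑ t ∈ Finset.range L, f ((L : ℤ) • boxVec N' z + boxVec L s + (t : ℤ) • e κ)
      = L • ∑ y : Fin d → Fin Nj, f (boxVec Nj y) := by
  subst hNj
  haveI : NeZero (N' * L) := ⟨Nat.mul_ne_zero (NeZero.ne N') (by omega)⟩
  -- bring `t` outside
  have hswap : ∑ z : Fin d → Fin N', ∑ s : Fin d → Fin L, ∑ t ∈ Finset.range L, f ((L : ℤ) • boxVec N' z + boxVec L s + (t : ℤ) • e κ)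
      = ∑ t ∈ Finset.range L, ∑ z : Fin d → Fin N', ∑ s : Fin d → Fin L, f ((L : ℤ) • boxVec N' z + boxVec L s + (t : ℤ) • e κ) := by
    calc _ = ∑ z : Fin d → Fin N', ∑ t ∈ Finset.range L, ∑ s : Fin d → Fin L, f ((L : ℤ) • boxVec N' z + boxVec L s + (t : ℤ) • e κ) :=
          Finset.sum_congr rfl fun z _ => Finset.sum_comm
      _ = _ := Finset.sum_comm
  -- each `t`: an exact tiling of the cell shifted by `t•e_κ`
  have ht : ∀ t : ℕ, ∑ z : Fin d → Fin N', ∑ s : Fin d → Fin L, f ((L : ℤ) • boxVec N' z + boxVec L s + (t : ℤ) • e κ)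
      = ∑ y : Fin d → Fin (N' * L), f (boxVec (N' * L) y) := by
    intro t
    have htile := sum_cell_tiling N' L hL (fun y => f (y + (t : ℤ) • e κ))
    have hsh := sum_cell_shift_vec (N' * L) f hfp ((t : ℤ) • e κ)
    rw [← hsh, htile]
  rw [hswap, Finset.sum_congr rfl fun t _ => ht t, Finset.sum_const, Finset.card_range]

end Summit.QuantumFields.YangMills.Theorems.Prop7CellBoxMultiplicity

end
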